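import Mathlib
import HarnessLib

/-!
# `TeissierResolve`, line `Sketch` (toric normalisation + destackification): closed points suffice

Route `ResolutionOfSingularities/TeissierJung`, crux `TeissierResolve`
(stmt-ResolutionOfSingularities-17086), stub `stub_closedPointsSuffice` of the lead's skeleton,
PROVED here (statement verbatim from the ledger registration).

**Statement.** Let `X → Spec k` be a quasi-compact morphism, locally of finite type, from a scheme
`X` to the spectrum of a field `k`. Suppose that every CLOSED point of `X` lies in the image of an
étale Bergh–Rydh chart `Spec S₀ → X` over `k` (`S` a smooth finitely generated `k`-algebra graded by
a finite abelian group `A`, `S₀` its degree-`0` part). Then EVERY point of `X` lies in the image of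
such a chart (with literally the same chart data).

**Proof.** `X` is quasi-compact as a space (quasi-compact over the quasi-compact `Spec k`,
`QuasiCompact.compactSpace_of_compactSpace`) and T₀, so the nonempty closed set `closure {x}`
contains a closed point `x₀` (`IsClosed.exists_closed_singleton`), i.e. `x ⤳ x₀`. Take the chart
`φ : Spec S₀ → X` at `x₀`. An étale morphism is smooth, hence flat and locally of finite
presentation, hence (universally) open (`UniversallyOpen.of_flat`, EGA IV₂ 2.4.6), so `range φ` is
an open set containing `x₀`, and therefore contains its generisation `x` (`Specializes.mem_open`).

Sources: EGA IV₂ (2.4.6) (flat + locally of finite presentation ⇒ open); Görtz–Wedhorn,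
*Algebraic Geometry I*, Thm. 14.35 and §3.13 (very dense subsets / closed points of finite-type
schemes). Everything here is [folklore]; no definitions, no named facts.
-/

noncomputable section

set_option linter.dupNamespace false -- mandated namespace of this single-conjunct summit

open CategoryTheory AlgebraicGeometry TopologicalSpace

namespace Summit.ResolutionOfSingularities.ResolutionOfSingularities.Theorems.TeissierResolve.ClosedPointsSuffice

/-- In a quasi-compact scheme every point specialises to a closed point: the closure of `{x}` is a
nonempty closed subset of a compact T₀ space, so it contains a closed point
(`IsClosed.exists_closed_singleton`). [folklore] -/
theorem exists_specializes_isClosed (X : Scheme.{0}) [CompactSpace X] (x : X) :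
    ∃ x₀ : X, x ⤳ x₀ ∧ IsClosed ({x₀} : Set X) := by
  obtain ⟨x₀, hx₀, hx₀c⟩ :=
    (isClosed_closure (s := ({x} : Set X))).exists_closed_singleton ⟨x, subset_closure rfl⟩
  exact ⟨x₀, specializes_iff_mem_closure.mpr hx₀, hx₀c⟩

/-- The image of an étale morphism of schemes is open: étale ⇒ smooth ⇒ flat and locally of finite
presentation ⇒ universally open (EGA IV₂ 2.4.6, Mathlib `UniversallyOpen.of_flat`). [folklore] -/
theorem isOpen_range_of_etale {X Y : Scheme.{0}} (φ : X ⟶ Y) [Etale φ] :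
    IsOpen (Set.range φ) :=
  φ.isOpenMap.isOpen_range

/-- **Closed points suffice for Bergh–Rydh charts.** For a scheme `X` quasi-compact and locally of
finite type over a field `k`: if every closed point of `X` is in the image of an étale chart
`Spec S₀ → X` over `k` (`S` smooth of finite type over `k`, graded by a finite abelian group, `S₀`
its degree-`0` part), then so is every point `x` — with the same chart at a closed specialisation
`x₀` of `x`, because the image of an étale morphism is open and open sets are stable under
generisation. [folklore] -/
theorem stub_closedPointsSuffice {k : Type} [Field k] (X : Scheme.{0}) (g : X ⟶ Spec (.of k))
    [LocallyOfFiniteType g] [QuasiCompact g]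
    (h : ∀ x : X, IsClosed ({x} : Set X) →
      ∃ (A : Type) (_ : AddCommGroup A) (_ : Finite A) (_ : DecidableEq A)
        (S : Type) (_ : CommRing S) (_ : Algebra k S) (𝒮 : A → Submodule k S)
        (_ : GradedAlgebra 𝒮), Algebra.FiniteType k S ∧ Algebra.Smooth k S ∧
        ∃ φ : Spec (.of (𝒮 0)) ⟶ X, Etale φ ∧ x ∈ Set.range φ ∧
          φ ≫ g = Spec.map (CommRingCat.ofHom (algebraMap k (𝒮 0))))
    (x : X) :
    ∃ (A : Type) (_ : AddCommGroup A) (_ : Finite A) (_ : DecidableEq A)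
      (S : Type) (_ : CommRing S) (_ : Algebra k S) (𝒮 : A → Submodule k S)
      (_ : GradedAlgebra 𝒮), Algebra.FiniteType k S ∧ Algebra.Smooth k S ∧
      ∃ φ : Spec (.of (𝒮 0)) ⟶ X, Etale φ ∧ x ∈ Set.range φ ∧
        φ ≫ g = Spec.map (CommRingCat.ofHom (algebraMap k (𝒮 0))) := by
  haveI : CompactSpace X := QuasiCompact.compactSpace_of_compactSpace g
  obtain ⟨x₀, hsp, hx₀c⟩ := exists_specializes_isClosed X x
  obtain ⟨A, iA, iF, iD, S, iS, iSk, 𝒮, i𝒮, hft, hsm, φ, hφ, hx₀φ, hg⟩ := h x₀ hx₀c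
  exact ⟨A, iA, iF, iD, S, iS, iSk, 𝒮, i𝒮, hft, hsm, φ, hφ,
    hsp.mem_open (isOpen_range_of_etale φ) hx₀φ, hg⟩

end Summit.ResolutionOfSingularities.ResolutionOfSingularities.Theorems.TeissierResolve.ClosedPointsSuffice

end
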